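import Mathlib

/-!
# Flat-model certificate: the capped Klein-bottle bundle `N̂_P = Kb ×_ĉ S¹` is the second amphicosm
(algebraic core of THEOREM 11.31(a),(b),(d) of the residency file `paper/poincare-sphere-trick.md`,
solo residency `solo-SmoothPoincare4-informed`, session 13; a prose result under adjudication, not a
theorem of this tree).

Geometric provenance (prose, not formalised).  `N_P = P ×_c S¹` is the mapping torus of the fold
involution `c` of the once-punctured Klein bottle `P` (`π₁ P = F(u,v)`, `c_* u = v`, `[∂P] = u² v⁻²`);
capping `∂P` by the meridian disc of a solid Klein bottle gives `N̂_P = Kb ×_ĉ S¹` with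
`π₁ = ⟨u, v ∣ u² = v²⟩ ⋊_ĉ ⟨ŝ⟩`, `ŝ u ŝ⁻¹ = v`, `ŝ v ŝ⁻¹ = u`.  THEOREM 11.31 realises this group
by affine isometries of `ℝ³` — `u (x,y,t) = (x+½, −y, t)`, `v (x,y,t) = (x+½, 1−y, t)`,
`ŝ (x,y,t) = (x, ½−y, t+1)` — and reads off: the sections `γ_t = u ŝ`, `γ_s = v ŝ`, `γ_T = u⁻¹ ŝ`,
`γ_S = v⁻¹ ŝ` are pure translations by `d_t = (½,−½,1)`, `d_s = (½,½,1)`, `d_T = (−½,−½,1)`,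
`d_S = (−½,½,1)`; the translation lattice is `Λ = ⟨e₁, e₂, σ⟩`, `σ = (−½,½,1)`; the core `C′` of the
removed solid Klein bottle lifts to the direction `f = (0,0,2) = ŝ²`; and `{d_s, d_t, f}` is a basis of
`Λ`, which is what identifies `(T³; C̃′, γ̃₁, γ̃₂)` with the cores of `0`-surgery on the Borromean
rings (THEOREM 11.31(d)).

What is proved here (exact rational arithmetic, kernel-checked): the defining relations of
`π₁(Kb) ⋊_ĉ ℤ` hold for the three affine maps (`rel_sq`, `rel_conj_u`, `rel_conj_v`); the four
one-letter section elements and `u²`, `u v⁻¹`, `ŝ²`, `u⁻¹ ŝ` are the stated translations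
(`sec_t`, `sec_s`, `sec_T`, `sec_S`, `sq_u`, `u_vinv`, `sq_s`, `sigma_eq`); every generator has linear
part `diag(1,−1,1)` or is a translation, so the holonomy is `{1, R}` (`lin_u`, `lin_v`, `lin_s`);
and the change of basis between `(e₁, e₂, σ)` and `(d_s, d_t, f)` is unimodular in both directions
(`basis_to`, `basis_from`), i.e. `{d_s, d_t, f}` is a `ℤ`-basis of `Λ`.
-/

namespace Summit.SmoothPoincare4.SmoothPoincare4.Theorems
namespace FlatModel

/-- Points of `ℚ³` (the model is rational; `ℝ³` plays no role in the identities). -/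
abbrev Pt := ℚ × ℚ × ℚ

/-- The glide reflection `u (x,y,t) = (x + ½, −y, t)` (core loop of one Möbius half of `Kb`). -/
def U (p : Pt) : Pt := (p.1 + 1/2, -p.2.1, p.2.2)
/-- The glide reflection `v (x,y,t) = (x + ½, 1 − y, t)` (`= c_* u`). -/
def V (p : Pt) : Pt := (p.1 + 1/2, 1 - p.2.1, p.2.2)
/-- Inverse of `u`. -/
def Ui (p : Pt) : Pt := (p.1 - 1/2, -p.2.1, p.2.2)
/-- Inverse of `v`. -/
def Vi (p : Pt) : Pt := (p.1 - 1/2, 1 - p.2.1, p.2.2)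
/-- The deck generator `ŝ (x,y,t) = (x, ½ − y, t + 1)` realising the fold `ĉ` (reflection of `Kb`
in the two-sided circle `y ≡ ¼`) composed with unit time translation. -/
def S (p : Pt) : Pt := (p.1, 1/2 - p.2.1, p.2.2 + 1)
/-- Inverse of `ŝ`. -/
def Si (p : Pt) : Pt := (p.1, 1/2 - p.2.1, p.2.2 - 1)
/-- Translation by a vector. -/
def tr (d : Pt) (p : Pt) : Pt := (p.1 + d.1, p.2.1 + d.2.1, p.2.2 + d.2.2)

/-- `Ui` is a two-sided inverse of `U`. -/
theorem U_inv (p : Pt) : Ui (U p) = p ∧ U (Ui p) = p := by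
  constructor
  · refine Prod.ext ?_ (Prod.ext ?_ ?_)
    all_goals simp only [U, Ui]
    all_goals ring
  · refine Prod.ext ?_ (Prod.ext ?_ ?_)
    all_goals simp only [U, Ui]
    all_goals ring
/-- `Vi` is a two-sided inverse of `V`. -/
theorem V_inv (p : Pt) : Vi (V p) = p ∧ V (Vi p) = p := by
  constructor
  · refine Prod.ext ?_ (Prod.ext ?_ ?_)
    all_goals simp only [V, Vi]
    all_goals ring
  · refine Prod.ext ?_ (Prod.ext ?_ ?_)
    all_goals simp only [V, Vi]
    all_goals ring
/-- `Si` is a two-sided inverse of `S`. -/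
theorem S_inv (p : Pt) : Si (S p) = p ∧ S (Si p) = p := by
  constructor
  · refine Prod.ext ?_ (Prod.ext ?_ ?_)
    all_goals simp only [S, Si]
    all_goals ring
  · refine Prod.ext ?_ (Prod.ext ?_ ?_)
    all_goals simp only [S, Si]
    all_goals ring

/-- Relation `u² = v²` of `π₁(Kb) = ⟨u, v ∣ u² = v²⟩`. -/
theorem rel_sq (p : Pt) : U (U p) = V (V p) := by
  refine Prod.ext ?_ (Prod.ext ?_ ?_)
  all_goals simp only [U, V]
  all_goals ring
/-- `u²` is the translation `e₁ = (1,0,0)`. -/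
theorem sq_u (p : Pt) : U (U p) = tr (1, 0, 0) p := by
  refine Prod.ext ?_ (Prod.ext ?_ ?_)
  all_goals simp only [U, tr]
  all_goals ring
/-- Relation `ŝ u ŝ⁻¹ = v` (the fold swaps the two Möbius halves: `ĉ_* u = v`). -/
theorem rel_conj_u (p : Pt) : S (U (Si p)) = V p := by
  refine Prod.ext ?_ (Prod.ext ?_ ?_)
  all_goals simp only [U, V, S, Si]
  all_goals ring
/-- Relation `ŝ v ŝ⁻¹ = u`. -/
theorem rel_conj_v (p : Pt) : S (V (Si p)) = U p := by
  refine Prod.ext ?_ (Prod.ext ?_ ?_)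
  all_goals simp only [U, V, S, Si]
  all_goals ring

/-- Linear part of `u` is `R = diag(1,−1,1)`: `u p − u 0 = R p` componentwise. -/
theorem lin_u (p : Pt) : (U p).1 - (U 0).1 = p.1 ∧ (U p).2.1 - (U 0).2.1 = -p.2.1 ∧
    (U p).2.2 - (U 0).2.2 = p.2.2 := by
  simp only [U, Prod.fst_zero, Prod.snd_zero]; refine ⟨by ring, by ring, by ring⟩
/-- Linear part of `v` is `R = diag(1,−1,1)`. -/
theorem lin_v (p : Pt) : (V p).1 - (V 0).1 = p.1 ∧ (V p).2.1 - (V 0).2.1 = -p.2.1 ∧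
    (V p).2.2 - (V 0).2.2 = p.2.2 := by
  simp only [V, Prod.fst_zero, Prod.snd_zero]; refine ⟨by ring, by ring, by ring⟩
/-- Linear part of `ŝ` is `R = diag(1,−1,1)`; hence the holonomy group is `{1, R}` and a product of
an even number of generators `u^{±1}, v^{±1}, ŝ^{±1}` — in particular `w ŝ` for a word `w` of odd
length — is a pure translation. -/
theorem lin_s (p : Pt) : (S p).1 - (S 0).1 = p.1 ∧ (S p).2.1 - (S 0).2.1 = -p.2.1 ∧
    (S p).2.2 - (S 0).2.2 = p.2.2 := by
  simp only [S, Prod.fst_zero, Prod.snd_zero]; refine ⟨by ring, by ring, by ring⟩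

/-- Section `γ_t = u ŝ` is the translation `d_t = (½, −½, 1)`. -/
theorem sec_t (p : Pt) : U (S p) = tr (1/2, -1/2, 1) p := by
  refine Prod.ext ?_ (Prod.ext ?_ ?_)
  all_goals simp only [U, S, tr]
  all_goals ring
/-- Section `γ_s = v ŝ` is the translation `d_s = (½, ½, 1)`. -/
theorem sec_s (p : Pt) : V (S p) = tr (1/2, 1/2, 1) p := by
  refine Prod.ext ?_ (Prod.ext ?_ ?_)
  all_goals simp only [V, S, tr]
  all_goals ring
/-- Section `γ_T = u⁻¹ ŝ` is the translation `d_T = (−½, −½, 1)`. -/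
theorem sec_T (p : Pt) : Ui (S p) = tr (-1/2, -1/2, 1) p := by
  refine Prod.ext ?_ (Prod.ext ?_ ?_)
  all_goals simp only [Ui, S, tr]
  all_goals ring
/-- Section `γ_S = v⁻¹ ŝ` is the translation `d_S = (−½, ½, 1) = σ`. -/
theorem sec_S (p : Pt) : Vi (S p) = tr (-1/2, 1/2, 1) p := by
  refine Prod.ext ?_ (Prod.ext ?_ ?_)
  all_goals simp only [Vi, S, tr]
  all_goals ring
/-- `u v⁻¹` is the translation `−e₂`, so `e₂ ∈ Λ`. -/
theorem u_vinv (p : Pt) : U (Vi p) = tr (0, -1, 0) p := by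
  refine Prod.ext ?_ (Prod.ext ?_ ?_)
  all_goals simp only [U, Vi, tr]
  all_goals ring
/-- `ŝ²` is the translation `f = (0,0,2)`: the lifted core `C̃′` closes up after `t`-length `2`. -/
theorem sq_s (p : Pt) : S (S p) = tr (0, 0, 2) p := by
  refine Prod.ext ?_ (Prod.ext ?_ ?_)
  all_goals simp only [S, tr]
  all_goals ring
/-- The Reidemeister move `t ~ s`: conjugating the section element `u ŝ` by `u⁻¹` gives `ŝ u = v ŝ`
(because `ŝ u ŝ⁻¹ = v`), so `γ_t` and `γ_s` are conjugate in `Ĝ` and freely homotopic in `N̂_P`: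
`u⁻¹ ∘ (u ∘ ŝ) ∘ u = v ∘ ŝ` as maps. -/
theorem t_conj_s (p : Pt) : Ui (U (S (U p))) = V (S p) := by
  refine Prod.ext ?_ (Prod.ext ?_ ?_)
  all_goals simp only [U, V, Ui, S]
  all_goals ring

/-- The lattice vector `e₁`. -/
def e₁ : Pt := (1, 0, 0)
/-- The lattice vector `e₂`. -/
def e₂ : Pt := (0, 1, 0)
/-- The lattice vector `σ = (−½, ½, 1)` (`= d_S`). -/
def σ : Pt := (-1/2, 1/2, 1)
/-- Direction of the lifted one-letter section `γ̃₁`: `d_s`. -/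
def ds : Pt := (1/2, 1/2, 1)
/-- Direction of `γ̃₂ = ι γ̃₁`: `d_t = R d_s`. -/
def dt : Pt := (1/2, -1/2, 1)
/-- Direction of the lifted core geodesic `C̃′`: `f = (0,0,2)`. -/
def f : Pt := (0, 0, 2)

/-- Integer change of basis `(d_s, d_t, f)` in terms of `(e₁, e₂, σ)`:
`d_s = e₁ + σ`, `d_t = e₁ − e₂ + σ`, `f = e₁ − e₂ + 2σ`. -/
theorem basis_to : ds = e₁ + σ ∧ dt = e₁ - e₂ + σ ∧ f = e₁ - e₂ + (2:ℚ) • σ := by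
  refine ⟨?_, ?_, ?_⟩ <;> (refine Prod.ext ?_ (Prod.ext ?_ ?_)) <;>
    (simp only [ds, dt, f, e₁, e₂, σ, Prod.fst_add, Prod.snd_add, Prod.fst_sub, Prod.snd_sub,
        Prod.smul_fst, Prod.smul_snd, smul_eq_mul]; norm_num)
/-- Integer change of basis back: `e₁ = d_s + d_t − f`, `e₂ = d_s − d_t`, `σ = f − d_t`; with
`basis_to` this shows `{d_s, d_t, f}` is a `ℤ`-basis of `Λ = ⟨e₁, e₂, σ⟩` (the Borromean-core
criterion of THEOREM 11.31(d)). -/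
theorem basis_from : e₁ = ds + dt - f ∧ e₂ = ds - dt ∧ σ = f - dt := by
  refine ⟨?_, ?_, ?_⟩ <;> (refine Prod.ext ?_ (Prod.ext ?_ ?_)) <;>
    (simp only [ds, dt, f, e₁, e₂, σ, Prod.fst_add, Prod.snd_add, Prod.fst_sub, Prod.snd_sub]; norm_num)
/-- The determinant `det(d_s, d_t, f) = −1` (unimodular), by cofactor expansion. -/
theorem det_basis : ds.1 * (dt.2.1 * f.2.2 - dt.2.2 * f.2.1) - ds.2.1 * (dt.1 * f.2.2 - dt.2.2 * f.1)
    + ds.2.2 * (dt.1 * f.2.1 - dt.2.1 * f.1) = -1 := by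
  simp only [ds, dt, f]; norm_num

/-- The planes `Π_c = {x − (ε/2) t = c}` of THEOREM 11.31(e) for `ε = 1`: `u` shifts the level by `½`
(so no plane is `u`-invariant and each projects to an embedded two-sided torus), the sections `d_s`,
`d_t` and `e₂` are level directions, and `f` changes the level by `−1 = −ε` (the fibre torus meets
`C′` in `k = |ε|` points). -/
theorem plane_levels (p : Pt) :
    ((U p).1 - (1/2) * (U p).2.2) = (p.1 - (1/2) * p.2.2) + 1/2 ∧
    (ds.1 - (1/2) * ds.2.2 = 0) ∧ (dt.1 - (1/2) * dt.2.2 = 0) ∧ (e₂.1 - (1/2) * e₂.2.2 = 0) ∧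
    (f.1 - (1/2) * f.2.2 = -1) := by
  refine ⟨?_, ?_, ?_, ?_, ?_⟩
  · simp only [U]; ring
  all_goals (simp only [ds, dt, e₂, f]; norm_num)

end FlatModel
end Summit.SmoothPoincare4.SmoothPoincare4.Theorems
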